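import Summits.AtomisticToContinuum.HydrodynamicLimit.Theorems.BoxDissipativeWeakStrongFluxClosureKinStaticGeneral
import Summits.AtomisticToContinuum.HydrodynamicLimit.Theorems.BoxDissipativeWeakStrongFluxClosureEntBoxDisjoint
import Mathlib.Probability.Independence.Integration
import Mathlib.Analysis.Convex.Integral
import HarnessLib

/-!
# Crux `FluxClosure` (stmt-AtomisticToContinuum-9902, route BoxDissipativeWeakStrong), line `registered`:
# the speed-`(N+1)` exponential moment of the K-integrand under a general local Gibbs measure (sub-goal H1b)

Support file (`--supports stmt-AtomisticToContinuum-9902`) for the crux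
`Summit.AtomisticToContinuum.HydrodynamicLimit.Theses.BoxDissipativeWeakStrong.FluxClosure`: the registered
sub-goal H1b `kinEntry_expMoment_localGibbs_of_box` of the entropy line for the kinetic stub K. GIVEN the
box-level bound H1a2 (an exponential moment of `s n Σᵢⱼ |Aᵢⱼ(z, χ)|` under the Gaussian velocity law
`velMeasure` given the positions, for a one-box weight `χ`, with rate the number of particles seen by `χ`), it
proves `E exp(γ n |X_G|) ≤ exp(n (C (γB)² + γB C (δθ + δu²) + C (n l³)⁻¹))` (`n = N + 1`, `γ B ≤ γ₀`) for the
cube-kernel K-integrand `X_G(z) = ∫ₓ Σᵢⱼ Aᵢⱼ(z, K_l(x, ·)) Gᵢⱼ(x) dx` under `localGibbsMeasure σ a₀ u₀ θ₀ N`,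
uniformly in the window `0 < l ≤ 1` — the input of the entropy inequality of the relative-entropy method.
Proof (the classical block argument): `|X_G| ≤ B ∫ₓ F`, `F = Σᵢⱼ |Aᵢⱼ|` (integrable in `x`:
`sum_abs_kinEntry_le_energy`); the `x`-integral is the average over shifts `x` of the sum over the lattice
`x + k/m`, `k ∈ (Fin m)³`, `m = ⌊1/l⌋` (translation invariance), and JENSEN (`ofReal_exp_mul_integral_le`) gives
`exp(γ n |X_G|) ≤ ∫ₓ Πₖ exp(s n F(z, x + k/m)) dx`, `s = γ B m⁻³`; Tonelli, the disintegration
`lintegral_localGibbsMeasure`, and INDEPENDENCE OF DISJOINT BLOCKS under the product Gaussian law (the factor of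
the cube at `x + k/m` only sees the particles inside it, `kinFields_congr`; the cubes are disjoint,
`boxSet_disjoint_of_shift`; `lintegral_prod_eq_prod_lintegral_of_blocks` from Mathlib's `iIndepFun_pi`,
`iIndepFun.indepFun_finset`); the box-level bound per block (`s l⁻³ ≤ 8γB` as `m l ≥ 1/2`), `Σₖ #blockₖ ≤ n`,
`C₂^{m³} ≤ exp(C₂ l⁻³)`, `lintegral_posWeight_eq_one`. No definitions, no new facts.
References: H.-T. Yau, Lett. Math. Phys. 22 (1991) 63–80; S. Olla, S. R. S. Varadhan, H.-T. Yau, Comm. Math.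
Phys. 155 (1993) 523–560, §3; C. Kipnis, C. Landim, *Scaling Limits of Interacting Particle Systems* (1999),
App. 1 §8 and Ch. 6; H. Spohn, *Large Scale Dynamics of Interacting Particles* (1991), Part I §2.3.
-/

noncomputable section

namespace Summit.AtomisticToContinuum.HydrodynamicLimit.Theorems
namespace FluxClosureEnt

open scoped BigOperators Topology Classical MeasureTheory ProbabilityTheory InnerProductSpace ENNReal
open Filter Set Function MeasureTheory ProbabilityTheory
open Literature.MathematicalPhysics.KineticTheory Literature.Analysis.FluidPDE Literature.Analysis.FunctionSpaces
open Summit.AtomisticToContinuum.HydrodynamicLimit.Theses.BoxDissipativeWeakStrong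

/-- **Jensen's inequality for the exponential, robust `ℝ≥0∞` form.** For a probability measure `μ`, a
measurable `f ≥ 0` and `c ≥ 0`: `exp(c ∫ f dμ) ≤ ∫⁻ exp(c f) dμ` (if `f` is not integrable the left side is
`1`; if `exp(c f)` is not integrable the right side is `∞`; otherwise Mathlib's `ConvexOn.map_integral_le`). -/
theorem ofReal_exp_mul_integral_le {α : Type*} [MeasurableSpace α] {μ : Measure α} [IsProbabilityMeasure μ]
    {f : α → ℝ} (hf : Measurable f) (hf0 : ∀ x, 0 ≤ f x) {c : ℝ} (hc : 0 ≤ c) :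
    ENNReal.ofReal (Real.exp (c * ∫ x, f x ∂μ)) ≤ ∫⁻ x, ENNReal.ofReal (Real.exp (c * f x)) ∂μ := by
  by_cases hfi : Integrable f μ
  swap
  · rw [integral_undef hfi, mul_zero, Real.exp_zero, ENNReal.ofReal_one]
    calc (1 : ℝ≥0∞) = ∫⁻ _, 1 ∂μ := by rw [lintegral_const, measure_univ, mul_one]
      _ ≤ _ := lintegral_mono fun x => by
          rw [← ENNReal.ofReal_one]; exact ENNReal.ofReal_le_ofReal (Real.one_le_exp (mul_nonneg hc (hf0 x)))
  have hgm : Measurable fun x => Real.exp (c * f x) := (measurable_const.mul hf).exp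
  by_cases hgi : Integrable (fun x => Real.exp (c * f x)) μ
  · rw [← ofReal_integral_eq_lintegral_ofReal hgi (ae_of_all _ fun x => (Real.exp_pos _).le)]
    refine ENNReal.ofReal_le_ofReal ?_
    have hJ := (convexOn_exp).map_integral_le Real.continuous_exp.continuousOn isClosed_univ
      (by simp) (hfi.const_mul c) hgi
    rwa [integral_const_mul] at hJ
  · have htop : ∫⁻ x, ENNReal.ofReal (Real.exp (c * f x)) ∂μ = ∞ := by
      have h3 : ¬ HasFiniteIntegral (fun x => Real.exp (c * f x)) μ := fun h => hgi ⟨hgm.aestronglyMeasurable, h⟩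
      rwa [hasFiniteIntegral_iff_ofReal (ae_of_all _ fun x => (Real.exp_pos _).le), not_lt, top_le_iff] at h3
    exact htop ▸ le_top

/-- **The summed absolute K-integrand is dominated by the box energy**: for a weight `χ ≥ 0`,
`Σᵢⱼ |Aᵢⱼ(z, χ)| ≤ 42 Ê(z, χ)` (`|Ŝᵢⱼ| ≤ 2Ê`; `|m̂ᵢm̂ⱼ/ρ̂| ≤ 2Ê` and `|ρ̂θ̂| ≤ ⅔Ê` by Cauchy–Schwarz,
`DeviatoricStressClosure.abs_reynolds_le_and_abs_pressure_le`). Used only to make `x ↦ Σᵢⱼ |Aᵢⱼ(z, K(x, ·))|`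
integrable over the torus. -/
theorem sum_abs_kinEntry_le_energy {n : ℕ} (z : Config n (Fin 3) T3) {χ : T3 → ℝ} (hχ : ∀ y, 0 ≤ χ y) :
    ∑ i, ∑ j, |(∫ y, χ y.1 * (y.2 i * y.2 j) ∂(empiricalMeasure z)) -
        empiricalMomentumField z χ i * empiricalMomentumField z χ j / empiricalDensityField z χ -
        (if i = j then empiricalDensityField z χ * (2 / 3 * (empiricalEnergyField z χ / empiricalDensityField z χ -
          ‖empiricalMomentumField z χ‖ ^ 2 / (2 * empiricalDensityField z χ ^ 2))) else 0)| ≤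
      42 * empiricalEnergyField z χ := by
  have hw := FluxClosureK.weight_eq_translate χ 0
  obtain ⟨-, hE0, h1, h2⟩ := DeviatoricStressClosure.abs_reynolds_le_and_abs_pressure_le z 0
    (k := fun u => χ (0 - u)) (fun y => hχ _) (R := empiricalDensityField z χ) (Mv := empiricalMomentumField z χ)
    (En := empiricalEnergyField z χ) (by rw [← hw]) (by rw [← hw]) (by rw [← hw])
  have hS : ∀ i j, |∫ y, χ y.1 * (y.2 i * y.2 j) ∂(empiricalMeasure z)| ≤ 2 * empiricalEnergyField z χ := by
    intro i j
    rw [FluxClosureK.integral_weight_mul_vel_mul_vel, empiricalEnergyField_eq_sum, abs_mul,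
      abs_of_nonneg (inv_nonneg.2 (Nat.cast_nonneg n)), mul_left_comm]
    refine mul_le_mul_of_nonneg_left ?_ (inv_nonneg.2 (Nat.cast_nonneg n))
    rw [Finset.mul_sum]
    refine (Finset.abs_sum_le_sum_abs _ _).trans (Finset.sum_le_sum fun a _ => ?_)
    have hv : ∀ l, |(z a).2 l| ≤ ‖(z a).2‖ := fun l => (Real.norm_eq_abs _).symm.trans_le (PiLp.norm_apply_le _ l)
    rw [abs_mul, abs_of_nonneg (hχ _), abs_mul,
      show 2 * (χ (z a).1 * (‖(z a).2‖ ^ 2 / 2)) = χ (z a).1 * (‖(z a).2‖ * ‖(z a).2‖) by ring]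
    exact mul_le_mul_of_nonneg_left (mul_le_mul (hv i) (hv j) (abs_nonneg _) (norm_nonneg _)) (hχ _)
  calc _ ≤ ∑ i : Fin 3, ∑ j : Fin 3,
        (2 * empiricalEnergyField z χ + 2 * empiricalEnergyField z χ + 2 / 3 * empiricalEnergyField z χ) :=
        Finset.sum_le_sum fun i _ => Finset.sum_le_sum fun j _ => (abs_sub _ _).trans (add_le_add
          ((abs_sub _ _).trans (add_le_add (hS i j) (h1 i j))) (by
            split_ifs
            · exact h2
            · rw [abs_zero]; positivity))
    _ = 42 * empiricalEnergyField z χ := by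
        simp only [Finset.sum_const, Finset.card_univ, Fintype.card_fin]; ring

/-- **The box fields only see the particles in the support of the weight.** If two velocity configurations
agree at every particle `a` with `χ(qₐ) ≠ 0`, the `χ`-weighted box kinetic stress, density, momentum and
energy of `zipConfig (q, v)` and `zipConfig (q, v')` coincide (all four are averages `n⁻¹ Σₐ χ(qₐ) f(vₐ)`). -/
theorem kinFields_congr {n : ℕ} (q : Fin n → T3) (χ : T3 → ℝ) {v v' : Fin n → V3}
    (h : ∀ a, χ (q a) ≠ 0 → v a = v' a) :
    (∀ i j, ∫ y, χ y.1 * (y.2 i * y.2 j) ∂(empiricalMeasure (zipConfig (q, v))) =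
        ∫ y, χ y.1 * (y.2 i * y.2 j) ∂(empiricalMeasure (zipConfig (q, v')))) ∧
      empiricalDensityField (zipConfig (q, v)) χ = empiricalDensityField (zipConfig (q, v')) χ ∧
      empiricalMomentumField (zipConfig (q, v)) χ = empiricalMomentumField (zipConfig (q, v')) χ ∧
      empiricalEnergyField (zipConfig (q, v)) χ = empiricalEnergyField (zipConfig (q, v')) χ := by
  have key : ∀ a, χ (q a) = 0 ∨ v a = v' a := fun a => (eq_or_ne (χ (q a)) 0).imp_right (h a)
  refine ⟨fun i j => ?_, ?_, ?_, ?_⟩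
  · simp only [integral_empiricalMeasure, zipConfig_apply]
    exact congrArg _ (Finset.sum_congr rfl fun a _ => by rcases key a with hc | hc <;> simp [hc])
  · simp only [empiricalDensityField_eq_sum, zipConfig_apply]
  · simp only [empiricalMomentumField_eq_sum, zipConfig_apply]
    exact congrArg _ (Finset.sum_congr rfl fun a _ => by rcases key a with hc | hc <;> simp [hc])
  · simp only [empiricalEnergyField_eq_sum, zipConfig_apply]
    exact congrArg _ (Finset.sum_congr rfl fun a _ => by rcases key a with hc | hc <;> simp [hc])

/-- **Functions of disjoint coordinate blocks factorise under a product measure.** For probability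
measures `μₐ` on `ℝ³` (`a : Fin n`), measurable `Yₖ ≥ 0` on `(ℝ³)ⁿ` such that `Yₖ(v)` only depends on the
coordinates `vₐ, a ∈ Sₖ`, and pairwise disjoint `Sₖ` (`k ∈ B`): `∫ Πₖ Yₖ d(⊗μₐ) = Πₖ ∫ Yₖ d(⊗μₐ)` (induction on
`B`: the tuples over `S_{k₀}` and `⋃_{k ∈ B} Sₖ` are independent, `iIndepFun_pi`, `iIndepFun.indepFun_finset`,
hence so are `Y_{k₀}` and `Π_{k ∈ B} Yₖ` by composition with the extension-by-zero maps; `E[fg] = E[f]E[g]`). -/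
theorem lintegral_prod_eq_prod_lintegral_of_blocks {n : ℕ} (μ : Fin n → Measure V3)
    [∀ a, IsProbabilityMeasure (μ a)] {ι : Type*} (S : ι → Finset (Fin n)) (Y : ι → (Fin n → V3) → ℝ≥0∞)
    (hYm : ∀ k, Measurable (Y k)) (hdep : ∀ k (v v' : Fin n → V3), (∀ a ∈ S k, v a = v' a) → Y k v = Y k v')
    (B : Finset ι) (hS : ∀ k ∈ B, ∀ k' ∈ B, k ≠ k' → Disjoint (S k) (S k')) :
    ∫⁻ v, ∏ k ∈ B, Y k v ∂Measure.pi μ = ∏ k ∈ B, ∫⁻ v, Y k v ∂Measure.pi μ := by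
  classical
  have hext : ∀ U : Finset (Fin n), ∃ e : (U → V3) → (Fin n → V3), Measurable e ∧
      ∀ (v : Fin n → V3), ∀ a ∈ U, e (fun i : U => v i) a = v a := fun U =>
    ⟨fun w a => if h : a ∈ U then w ⟨a, h⟩ else 0,
      measurable_pi_lambda _ fun a => by
        by_cases h : a ∈ U
        · simp only [dif_pos h]; exact measurable_pi_apply _
        · simp only [dif_neg h]; exact measurable_const,
      fun v a ha => by simp [dif_pos ha]⟩
  induction B using Finset.induction_on with
  | empty => simp
  | insert k₀ B hk₀ ih =>
    have hS' : ∀ k ∈ B, ∀ k' ∈ B, k ≠ k' → Disjoint (S k) (S k') := fun k hk k' hk' =>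
      hS k (Finset.mem_insert_of_mem hk) k' (Finset.mem_insert_of_mem hk')
    have hdisj : Disjoint (S k₀) (B.biUnion S) := (Finset.disjoint_biUnion_right _ _ _).2 fun k hk =>
      hS k₀ (Finset.mem_insert_self _ _) k (Finset.mem_insert_of_mem hk) (fun h => hk₀ (h ▸ hk))
    obtain ⟨e₁, he₁, he₁v⟩ := hext (S k₀)
    obtain ⟨e₂, he₂, he₂v⟩ := hext (B.biUnion S)
    have hPm : Measurable fun v => ∏ k ∈ B, Y k v := Finset.measurable_prod _ fun k _ => hYm k
    have hind : IndepFun (Y k₀) (fun v => ∏ k ∈ B, Y k v) (Measure.pi μ) :=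
      ((((iIndepFun_pi (μ := μ) (X := fun _ (w : V3) => w) fun _ => measurable_id.aemeasurable).indepFun_finset
        (S k₀) (B.biUnion S) hdisj fun i => measurable_pi_apply i).comp ((hYm k₀).comp he₁)
          (hPm.comp he₂)).congr
        (Eventually.of_forall fun v => hdep k₀ _ _ fun a ha => he₁v v a ha)
        (Eventually.of_forall fun v => Finset.prod_congr rfl fun k hk => hdep k _ _ fun a ha =>
          he₂v v a (Finset.mem_biUnion.2 ⟨k, hk, ha⟩)))
    rw [Finset.prod_insert hk₀, ← ih hS', ← lintegral_mul_eq_lintegral_mul_lintegral_of_indepFun''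
      (hYm k₀).aemeasurable hPm.aemeasurable hind]
    exact lintegral_congr fun v => by rw [Finset.prod_insert hk₀]

/-- **Block assembly.** Let `K ≥ 0` be a bounded jointly measurable kernel, `c : ι → 𝕋³` a finite
family of shifts whose shifted kernels have DISJOINT supports (`K(x + cₖ, y) ≠ 0 ⇒ K(x + cₖ', y) = 0`,
`k ≠ k'`), and suppose the box-level bound: for all positions `q` and centres `y`,
`∫ exp(s n Σᵢⱼ |Aᵢⱼ(zipConfig(q, v), K(y, ·))|) velMeasure(dv) ≤ R₁ exp(#{a | K(y, qₐ) ≠ 0} E₁)`. Then for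
`|Gᵢⱼ| ≤ B`, `γ B ≤ s #ι`: `E_{P_N} exp(γ n |∫ₓ Σᵢⱼ Aᵢⱼ(z, K(x, ·)) Gᵢⱼ(x) dx|) ≤ R₁^{#ι} exp(n E₁)` (Jensen over
the shift average, Tonelli, disintegration, independence of disjoint blocks, `Σₖ #Sₖ ≤ n`). -/
theorem lintegral_exp_kinEntry_le_of_blocks {σ : ℝ} {a₀ θ₀ : T3 → ℝ} {u₀ : T3 → V3} (hσ : σ ≤ 1 / 2)
    (ha : Continuous a₀) (hθc : Continuous θ₀) (hu : Continuous u₀) (ha0 : ∀ x, 0 < a₀ x)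
    (hθ0 : ∀ x, 0 < θ₀ x) (N : ℕ) {K : T3 → T3 → ℝ} {CK : ℝ} (hKm : Measurable fun p : T3 × T3 => K p.1 p.2)
    (hK0 : ∀ x y, 0 ≤ K x y) (hKC : ∀ x y, K x y ≤ CK) {ι : Type*} [Fintype ι] (c : ι → T3)
    (hdisj : ∀ (x y : T3) (k k' : ι), k ≠ k' → K (x + c k) y ≠ 0 → K (x + c k') y = 0)
    {s R₁ E₁ : ℝ} (hs : 0 ≤ s) (hR₁ : 0 ≤ R₁) (hE₁ : 0 ≤ E₁)
    (hblock : ∀ (q : Fin (N + 1) → T3) (y : T3), ∫⁻ v, ENNReal.ofReal (Real.exp (s * ((N + 1 : ℕ) : ℝ) *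
      ∑ i, ∑ j, |(∫ y', K y y'.1 * (y'.2 i * y'.2 j) ∂(empiricalMeasure (zipConfig (q, v)))) -
        empiricalMomentumField (zipConfig (q, v)) (K y) i * empiricalMomentumField (zipConfig (q, v)) (K y) j /
          empiricalDensityField (zipConfig (q, v)) (K y) -
        (if i = j then empiricalDensityField (zipConfig (q, v)) (K y) * (2 / 3 *
          (empiricalEnergyField (zipConfig (q, v)) (K y) / empiricalDensityField (zipConfig (q, v)) (K y) -
            ‖empiricalMomentumField (zipConfig (q, v)) (K y)‖ ^ 2 /
              (2 * empiricalDensityField (zipConfig (q, v)) (K y) ^ 2))) else 0)|)) ∂(velMeasure u₀ θ₀ q) ≤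
      ENNReal.ofReal (R₁ * Real.exp (((Finset.univ.filter fun a => K y (q a) ≠ 0).card : ℝ) * E₁)))
    {G : T3 → Fin 3 → Fin 3 → ℝ} {B : ℝ} (hGB : ∀ x i j, |G x i j| ≤ B) {γ : ℝ} (hγ : 0 ≤ γ)
    (hγs : γ * B ≤ s * Fintype.card ι) :
    ∫⁻ z, ENNReal.ofReal (Real.exp (γ * ((N + 1 : ℕ) : ℝ) * |∫ x, ∑ i, ∑ j,
      ((∫ y, K x y.1 * (y.2 i * y.2 j) ∂(empiricalMeasure z)) -
        empiricalMomentumField z (K x) i * empiricalMomentumField z (K x) j / empiricalDensityField z (K x) -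
        (if i = j then empiricalDensityField z (K x) * (2 / 3 * (empiricalEnergyField z (K x) /
          empiricalDensityField z (K x) - ‖empiricalMomentumField z (K x)‖ ^ 2 /
            (2 * empiricalDensityField z (K x) ^ 2))) else 0)) * G x i j|))
      ∂(localGibbsMeasure σ a₀ u₀ θ₀ N) ≤
    ENNReal.ofReal (R₁ ^ Fintype.card ι * Real.exp (((N + 1 : ℕ) : ℝ) * E₁)) := by
  -- the summed absolute integrand `F` and the block factors `Y`
  obtain ⟨F, hF⟩ : ∃ F : Config (N + 1) (Fin 3) T3 → T3 → ℝ, ∀ z x, F z x = ∑ i, ∑ j,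
      |(∫ y, K x y.1 * (y.2 i * y.2 j) ∂(empiricalMeasure z)) -
        empiricalMomentumField z (K x) i * empiricalMomentumField z (K x) j / empiricalDensityField z (K x) -
        (if i = j then empiricalDensityField z (K x) * (2 / 3 * (empiricalEnergyField z (K x) /
          empiricalDensityField z (K x) - ‖empiricalMomentumField z (K x)‖ ^ 2 /
            (2 * empiricalDensityField z (K x) ^ 2))) else 0)| :=
    ⟨_, fun _ _ => rfl⟩
  haveI : IsProbabilityMeasure (localGibbsMeasure σ a₀ u₀ θ₀ N) :=
    isProbabilityMeasure_localGibbsMeasure ha hθc hu ha0 hθ0 hσ N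
  have hB0 : 0 ≤ B := (abs_nonneg _).trans (hGB 0 0 0)
  have hn0 : (0 : ℝ) ≤ ((N + 1 : ℕ) : ℝ) := Nat.cast_nonneg _
  have hF0 : ∀ z x, 0 ≤ F z x := fun z x => by
    rw [hF]; exact Finset.sum_nonneg fun i _ => Finset.sum_nonneg fun j _ => abs_nonneg _
  have hFm : Measurable fun p : Config (N + 1) (Fin 3) T3 × T3 => F p.1 p.2 := by
    simp only [hF]
    exact Finset.measurable_sum _ fun i _ => Finset.measurable_sum _ fun j _ =>
      (FluxClosureB5.measurable_kinDevIntegrand hKm i j).abs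
  obtain ⟨Y, hY⟩ : ∃ Y : ι → Config (N + 1) (Fin 3) T3 → T3 → ℝ≥0∞,
      ∀ k z x, Y k z x = ENNReal.ofReal (Real.exp (s * ((N + 1 : ℕ) : ℝ) * F z (x + c k))) :=
    ⟨_, fun _ _ _ => rfl⟩
  have hYm : ∀ k, Measurable fun p : Config (N + 1) (Fin 3) T3 × T3 => Y k p.1 p.2 := fun k => by
    simp only [hY]
    exact (measurable_const.mul (hFm.comp (measurable_fst.prodMk (measurable_snd.add_const (c k))))).exp.ennreal_ofReal
  have hYF : ∀ z x, ENNReal.ofReal (Real.exp (s * ((N + 1 : ℕ) : ℝ) * ∑ k, F z (x + c k))) = ∏ k, Y k z x :=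
      fun z x => by
    rw [Finset.mul_sum, Real.exp_sum, ENNReal.ofReal_prod_of_nonneg fun k _ => (Real.exp_pos _).le]
    simp only [hY]
  have hPm : Measurable fun p : Config (N + 1) (Fin 3) T3 × T3 => ∏ k, Y k p.1 p.2 :=
    Finset.measurable_prod _ fun k _ => hYm k
  have hGm : ∀ x : T3, Measurable fun z : Config (N + 1) (Fin 3) T3 => ∏ k, Y k z x := fun x =>
    hPm.comp (measurable_id.prodMk measurable_const)
  -- integrability of `F z ·` over the torus (bounded kernel, energy domination)
  have hKint : ∀ y : T3, Integrable (fun x : T3 => K x y) := fun y =>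
    (integrable_const CK).mono' (hKm.comp (measurable_id.prodMk measurable_const)).aestronglyMeasurable
      (ae_of_all _ fun x => by rw [Real.norm_eq_abs, abs_of_nonneg (hK0 x y)]; exact hKC x y)
  have hFi : ∀ z, Integrable (F z) := fun z => by
    refine Integrable.mono' ((((integrable_finsetSum Finset.univ fun a _ => (hKint (z a).1).mul_const
      (‖(z a).2‖ ^ 2 / 2)).const_mul (((N + 1 : ℕ) : ℝ)⁻¹)).const_mul 42))
      (hFm.comp (measurable_const.prodMk measurable_id)).aestronglyMeasurable (ae_of_all _ fun x => ?_)
    rw [Real.norm_eq_abs, abs_of_nonneg (hF0 z x), ← empiricalEnergyField_eq_sum, hF]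
    exact sum_abs_kinEntry_le_energy z (hK0 x)
  -- the bound for a fixed shift `x`: disintegration, independence of the blocks, the box-level bound
  have hx : ∀ x : T3, ∫⁻ z, ∏ k, Y k z x ∂(localGibbsMeasure σ a₀ u₀ θ₀ N) ≤
      ENNReal.ofReal (R₁ ^ Fintype.card ι * Real.exp (((N + 1 : ℕ) : ℝ) * E₁)) := by
    intro x
    rw [lintegral_localGibbsMeasure ha hθc hu (fun y => (ha0 y).le) hθ0 σ N (hGm x)]
    have hq : ∀ q : Fin (N + 1) → T3, ∫⁻ v, ∏ k, Y k (zipConfig (q, v)) x ∂(velMeasure u₀ θ₀ q) ≤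
        ENNReal.ofReal (R₁ ^ Fintype.card ι * Real.exp (((N + 1 : ℕ) : ℝ) * E₁)) := by
      intro q
      obtain ⟨S, hS⟩ : ∃ S : ι → Finset (Fin (N + 1)), ∀ k, S k = Finset.univ.filter fun a => K (x + c k) (q a) ≠ 0 :=
        ⟨_, fun _ => rfl⟩
      have hSd : ∀ k k', k ≠ k' → Disjoint (S k) (S k') := fun k k' hkk' => by
        rw [hS, hS, Finset.disjoint_filter]
        exact fun a _ ha => not_ne_iff.2 (hdisj x (q a) k k' hkk' ha)
      have hcard : (∑ k, ((S k).card : ℝ)) ≤ ((N + 1 : ℕ) : ℝ) := by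
        have h := (Finset.card_biUnion (s := Finset.univ) fun k _ k' _ hkk' => hSd k k' hkk').symm.trans_le
          (Finset.card_le_univ _)
        rw [Fintype.card_fin] at h; exact_mod_cast h
      have hprod : ∏ k, ENNReal.ofReal (R₁ * Real.exp (((S k).card : ℝ) * E₁)) ≤
          ENNReal.ofReal (R₁ ^ Fintype.card ι * Real.exp (((N + 1 : ℕ) : ℝ) * E₁)) := by
        rw [← ENNReal.ofReal_prod_of_nonneg fun k _ => by positivity, Finset.prod_mul_distrib,
          Finset.prod_const, Finset.card_univ, ← Real.exp_sum, ← Finset.sum_mul]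
        exact ENNReal.ofReal_le_ofReal (mul_le_mul_of_nonneg_left
          (Real.exp_le_exp.2 (mul_le_mul_of_nonneg_right hcard hE₁)) (pow_nonneg hR₁ _))
      calc ∫⁻ v, ∏ k, Y k (zipConfig (q, v)) x ∂(velMeasure u₀ θ₀ q)
          = ∏ k, ∫⁻ v, Y k (zipConfig (q, v)) x ∂(velMeasure u₀ θ₀ q) :=
            lintegral_prod_eq_prod_lintegral_of_blocks (fun a => gaussMeasure (u₀ (q a)) (θ₀ (q a))) S
              (fun k v => Y k (zipConfig (q, v)) x)
              (fun k => (hYm k).comp ((measurable_zipConfig.comp (measurable_const.prodMk measurable_id)).prodMk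
                measurable_const))
              (fun k v v' hvv' => by
                obtain ⟨h1, h2, h3, h4⟩ := kinFields_congr q (K (x + c k)) (v := v) (v' := v')
                  (fun a ha => hvv' a (by rw [hS]; exact Finset.mem_filter.2 ⟨Finset.mem_univ _, ha⟩))
                simp only [hY, hF, h1, h2, h3, h4])
              Finset.univ (fun k _ k' _ hkk' => hSd k k' hkk')
        _ ≤ ∏ k, ENNReal.ofReal (R₁ * Real.exp (((S k).card : ℝ) * E₁)) :=
            Finset.prod_le_prod (fun _ _ => bot_le) fun k _ => by
              rw [hS]; simp only [hY, hF]; exact hblock q (x + c k)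
        _ ≤ _ := hprod
    refine (lintegral_mono fun q => mul_le_mul' le_rfl (hq q)).trans ?_
    rw [lintegral_mul_const' _ _ ENNReal.ofReal_ne_top,
      lintegral_posWeight_eq_one ha hθc hu (fun y => (ha0 y).le) hθ0 σ N, one_mul]
  -- pointwise Jensen bound, Tonelli, and the bound for fixed `x`
  calc _ ≤ ∫⁻ z, (∫⁻ x, ∏ k, Y k z x) ∂(localGibbsMeasure σ a₀ u₀ θ₀ N) := by
        refine lintegral_mono fun z => ?_
        have hI : ∫ x, ∑ k, F z (x + c k) = Fintype.card ι * ∫ x, F z x := by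
          rw [integral_finsetSum _ fun k _ => (hFi z).comp_add_right (c k)]
          simp only [integral_add_right_eq_self (F z)]
          rw [Finset.sum_const, Finset.card_univ, nsmul_eq_mul]
        calc _ ≤ ENNReal.ofReal (Real.exp (s * ((N + 1 : ℕ) : ℝ) * ∫ x, ∑ k, F z (x + c k))) := by
              refine ENNReal.ofReal_le_ofReal (Real.exp_le_exp.2 ?_)
              calc _ ≤ γ * ((N + 1 : ℕ) : ℝ) * (B * ∫ x, F z x) := by
                    refine mul_le_mul_of_nonneg_left ?_ (mul_nonneg hγ hn0)
                    rw [← integral_const_mul, ← Real.norm_eq_abs]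
                    exact norm_integral_le_of_norm_le ((hFi z).const_mul B) (ae_of_all _ fun x => by
                      rw [Real.norm_eq_abs, hF]; exact FluxClosureEq.E6.kinStatic_abs_sum_mul_le (hGB x))
                _ = γ * B * (((N + 1 : ℕ) : ℝ) * ∫ x, F z x) := by ring
                _ ≤ s * Fintype.card ι * (((N + 1 : ℕ) : ℝ) * ∫ x, F z x) :=
                    mul_le_mul_of_nonneg_right hγs (mul_nonneg hn0 (integral_nonneg (hF0 z)))
                _ = s * ((N + 1 : ℕ) : ℝ) * ∫ x, ∑ k, F z (x + c k) := by rw [hI]; ring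
          _ ≤ ∫⁻ x, ENNReal.ofReal (Real.exp (s * ((N + 1 : ℕ) : ℝ) * ∑ k, F z (x + c k))) :=
              ofReal_exp_mul_integral_le (Finset.measurable_sum _ fun k _ =>
                hFm.comp (measurable_const.prodMk (measurable_add_const (c k))))
                (fun x => Finset.sum_nonneg fun k _ => hF0 z _) (mul_nonneg hs hn0)
          _ = ∫⁻ x, ∏ k, Y k z x := lintegral_congr fun x => hYF z x
    _ = ∫⁻ x, ∫⁻ z, ∏ k, Y k z x ∂(localGibbsMeasure σ a₀ u₀ θ₀ N) := lintegral_lintegral_swap hPm.aemeasurable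
    _ ≤ ∫⁻ _x : T3, ENNReal.ofReal (R₁ ^ Fintype.card ι * Real.exp (((N + 1 : ℕ) : ℝ) * E₁)) := lintegral_mono hx
    _ = _ := by rw [lintegral_const, measure_univ, mul_one]

/-- **Stub H1b of the entropy line for K (crux `FluxClosure`): the speed-`(N+1)` exponential moment of the
K-integrand under a general local Gibbs measure, from the box-level bound.** Assume the box-level bound
(conclusion of sub-goal H1a2): an exponential moment of `s n Σᵢⱼ |Aᵢⱼ(zipConfig(q, v), χ)|` under the
Gaussian velocity law given the positions, for one-box weights `0 ≤ χ ≤ C_χ` local for the profiles, with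
rate `#{a | χ(qₐ) ≠ 0}` and `s C_χ ≤ γ₂`. Then for every `θ_M` there are `C = 64 C₂ ≥ 0`, `γ₀ = γ₂/8 > 0` such
that for `σ ≤ 1/2`, continuous `a₀ > 0`, `0 < θ₀ ≤ θ_M`, `u₀`, every `N`, window `0 < l ≤ 1`, locality moduli
`(δu, δθ)` of the cube kernel `K_l`, measurable `|Gᵢⱼ| ≤ B`, `0 < γ`, `γ B ≤ γ₀`: `E_{P_N} exp(γ (N+1) |X_G|) ≤
exp((N+1) (C (γB)² + γB C (δθ + δu²) + C ((N+1) l³)⁻¹))`. Proof: `lintegral_exp_kinEntry_le_of_blocks` for the cube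
kernel and the lattice shifts `k/m`, `k ∈ (Fin m)³`, `m = ⌊1/l⌋` (disjoint cubes: `boxSet_disjoint_of_shift`,
`l ≤ 1/m`), `s = γ B m⁻³` (`s l⁻³ ≤ 8 γ B ≤ γ₂` as `m l ≥ 1/2`), `C₂^{m³} ≤ exp(C₂ l⁻³)`. -/
theorem kinEntry_expMoment_localGibbs_of_box : (∀ θM : ℝ, 0 < θM → ∃ C : ℝ, 0 ≤ C ∧ ∃ γ₀ : ℝ, 0 < γ₀ ∧ ∀ (n : ℕ) (q : Fin n → T3) (u₀ : T3 → V3) (θ₀ : T3 → ℝ), (∀ x, 0 < θ₀ x) → (∀ x, θ₀ x ≤ θM) → ∀ (χ : T3 → ℝ) (Cχ : ℝ), (∀ y, 0 ≤ χ y) → (∀ y, χ y ≤ Cχ) → ∀ (ū : V3) (θ' δu δθ : ℝ), 0 ≤ δu → δu ≤ 1 → 0 ≤ δθ → (∀ y, χ y ≠ 0 → ‖u₀ y - ū‖ ≤ δu ∧ |θ₀ y - θ'| ≤ δθ) → ∀ (s : ℝ), 0 ≤ s → s * Cχ ≤ γ₀ → ∫⁻ v, ENNReal.ofReal (Real.exp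 (s * (n : ℝ) * ∑ i, ∑ j, |(∫ y, χ y.1 * (y.2 i * y.2 j) ∂(empiricalMeasure (zipConfig (q, v)))) - empiricalMomentumField (zipConfig (q, v)) χ i * empiricalMomentumField (zipConfig (q, v)) χ j / empiricalDensityField (zipConfig (q, v)) χ - (if i = j then empiricalDensityField (zipConfig (q, v)) χ * (2 / 3 * (empiricalEnergyField (zipConfig (q, v)) χ / empiricalDensityField (zipConfig (q, v)) χ - ‖empiricalMomentumField (zipConfig (q, v)) χ‖ ^ 2 / (2 * empiricalDensityField (zipConfig (q, v)) χ ^ 2))) else 0)|)) ∂(velMeasure u₀ θ₀ q) ≤ ENNReal.ofReal (C * Real.exp (((Finset.univ.filter fun a => χ (q a) ≠ 0).card : ℝ) * (C * (s * Cχ) ^ 2 + s * Cχ * (C * (δθ + δu ^ 2)))))) → ∀ θM : ℝ, 0 < θM → ∃ C : ℝ, 0 ≤ C ∧ ∃ γ₀ : ℝ, 0 < γ₀ ∧ ∀ (σ : ℝ) (a₀ θ₀ : T3 → ℝ) (u₀ : T3 → V3), σ ≤ 1 / 2 → Continuous a₀ → Continuous θ₀ → Continuous u₀ → (∀ x, 0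 < a₀ x) → (∀ x, 0 < θ₀ x) → (∀ x, θ₀ x ≤ θM) → ∀ (N : ℕ) (l δu δθ : ℝ), 0 < l → l ≤ 1 → 0 ≤ δu → δu ≤ 1 → 0 ≤ δθ → (∀ x y : T3, indicator {y' : T3 | ∀ i, ‖y' i - x i‖ < l / 2} (fun _ => (l ^ 3)⁻¹) y ≠ 0 → ‖u₀ y - u₀ x‖ ≤ δu ∧ |θ₀ y - θ₀ x| ≤ δθ) → ∀ (G : T3 → Fin 3 → Fin 3 → ℝ) (B : ℝ), (∀ i j, Measurable fun x => G x i j) → (∀ x i j, |G x i j| ≤ B) → ∀ γ : ℝ, 0 < γ → γ * B ≤ γ₀ → let K := fun (x y : T3) => indicator {y' : T3 | ∀ i, ‖y' i - x i‖ < l / 2} (fun _ => (l ^ 3)⁻¹) y; let Dn := fun (z : Config (N + 1) (Fin 3) T3) (x : T3) => empiricalDensityField z (K x); let Mm := fun (z : Config (N + 1) (Fin 3) T3) (x : T3) => empiricalMomentumField z (K x); let En := fun (z : Config (N + 1) (Fin 3) T3) (x : T3) => empiricalEnergyField z (K x); let Sk := fun (z : Config (N + 1) (Fin 3) T3) (x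 : T3) (i j : Fin 3) => ∫ y, K x y.1 * (y.2 i * y.2 j) ∂(empiricalMeasure z); let Th := fun (r : ℝ) (m : V3) (E : ℝ) => 2 / 3 * (E / r - ‖m‖ ^ 2 / (2 * r ^ 2)); ∫⁻ z, ENNReal.ofReal (Real.exp (γ * ((N : ℝ) + 1) * |∫ x, ∑ i, ∑ j, (Sk z x i j - Mm z x i * Mm z x j / Dn z x - (if i = j then Dn z x * Th (Dn z x) (Mm z x) (En z x) else 0)) * G x i j|)) ∂(localGibbsMeasure σ a₀ u₀ θ₀ N) ≤ ENNReal.ofReal (Real.exp (((N : ℝ) + 1) * (C * (γ * B) ^ 2 + γ * B * (C * (δθ + δu ^ 2)) + C * (((N : ℝ) + 1) * l ^ 3)⁻¹))) := by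
  intro hBOX θM hθM
  obtain ⟨C₂, hC₂, γ₂, hγ₂, hbox⟩ := hBOX θM hθM
  refine ⟨64 * C₂, by positivity, γ₂ / 8, by positivity, ?_⟩
  intro σ a₀ θ₀ u₀ hσ ha hθc hu ha0 hθ0 hθM' N l δu δθ hl hl1 hδu0 hδu1 hδθ hloc G B _ hGB γ hγ hγB
  dsimp only
  rw [← Nat.cast_add_one]
  -- the lattice `k/m`, `k ∈ (Fin m)³`, `m = ⌊1/l⌋`
  obtain ⟨m, hm⟩ : ∃ m : ℕ, m = ⌊1 / l⌋₊ := ⟨_, rfl⟩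
  have hm0 : 0 < m := by rw [hm, Nat.floor_pos, one_le_div hl]; exact hl1
  have hmR : (0 : ℝ) < m := Nat.cast_pos.2 hm0
  have hmle : (m : ℝ) ≤ 1 / l := by rw [hm]; exact Nat.floor_le (by positivity)
  have hml : l ≤ 1 / (m : ℝ) := by
    rw [le_div_iff₀ hmR, mul_comm]
    simpa only [one_div_mul_cancel hl.ne'] using mul_le_mul_of_nonneg_right hmle hl.le
  have hlm : 1 ≤ 2 * ((m : ℝ) * l) := by
    have h1 : 1 / l < m + 1 := by rw [hm]; exact Nat.lt_floor_add_one _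
    rw [div_lt_iff₀ hl] at h1
    nlinarith [show (1 : ℝ) ≤ m by exact_mod_cast hm0]
  have hB0 : 0 ≤ B := (abs_nonneg _).trans (hGB 0 0 0)
  obtain ⟨s, hs⟩ : ∃ s : ℝ, s = γ * B * ((m : ℝ) ^ 3)⁻¹ := ⟨_, rfl⟩
  have hs0 : 0 ≤ s := by rw [hs]; exact mul_nonneg (mul_nonneg hγ.le hB0) (by positivity)
  have hsl : s * (l ^ 3)⁻¹ ≤ 8 * (γ * B) := by
    have h8 : ((m : ℝ) ^ 3)⁻¹ * (l ^ 3)⁻¹ ≤ 8 := by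
      rw [← mul_inv, ← mul_pow, inv_le_comm₀ (by positivity) (by norm_num)]
      calc (8 : ℝ)⁻¹ = (1 / 2) ^ 3 := by norm_num
        _ ≤ ((m : ℝ) * l) ^ 3 := pow_le_pow_left₀ (by norm_num) (by linarith) 3
    rw [hs, mul_assoc, mul_comm 8]
    exact mul_le_mul_of_nonneg_left h8 (mul_nonneg hγ.le hB0)
  have hsγ : s * (l ^ 3)⁻¹ ≤ γ₂ := hsl.trans (by linarith)
  have hcard : Fintype.card (Fin 3 → Fin m) = m ^ 3 := by simp
  have hmain := lintegral_exp_kinEntry_le_of_blocks hσ ha hθc hu ha0 hθ0 N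
    (K := fun x y => indicator {y' : T3 | ∀ i, ‖y' i - x i‖ < l / 2} (fun _ => (l ^ 3)⁻¹) y)
    (LGFS.measurable_boxK_uncurry l) (fun x y => LGFS.boxK_nonneg hl.le x y) (fun x y => LGFS.boxK_le hl.le x y)
    (ι := Fin 3 → Fin m) (fun k i => (((((k i : ℕ) : ℝ) / (m : ℝ)) : ℝ) : UnitAddCircle))
    (fun x y k k' hkk' hk => by
      by_contra hk'
      exact Set.disjoint_left.1 (boxSet_disjoint_of_shift m hm0 l hl hml x k k' hkk')
        (Set.mem_of_indicator_ne_zero hk) (Set.mem_of_indicator_ne_zero hk'))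
    hs0 hC₂ (E₁ := C₂ * (s * (l ^ 3)⁻¹) ^ 2 + s * (l ^ 3)⁻¹ * (C₂ * (δθ + δu ^ 2))) (by positivity)
    (fun q y => hbox (N + 1) q u₀ θ₀ hθ0 hθM' _ ((l ^ 3)⁻¹) (fun y' => LGFS.boxK_nonneg hl.le y y')
      (fun y' => LGFS.boxK_le hl.le y y') (u₀ y) (θ₀ y) δu δθ hδu0 hδu1 hδθ (fun y' hy' => hloc y y' hy')
      s hs0 hsγ)
    hGB hγ.le (by rw [hcard, Nat.cast_pow, hs, inv_mul_cancel_right₀ (pow_ne_zero 3 hmR.ne')])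
  refine hmain.trans (ENNReal.ofReal_le_ofReal ?_)
  rw [hcard]
  obtain ⟨n, hn, hnpos⟩ : ∃ n : ℝ, ((N + 1 : ℕ) : ℝ) = n ∧ 0 < n := ⟨_, rfl, by positivity⟩
  rw [hn]
  obtain ⟨t, ht⟩ : ∃ t : ℝ, s * (l ^ 3)⁻¹ = t := ⟨_, rfl⟩
  rw [ht] at hsl ⊢
  have ht0 : 0 ≤ t := by rw [← ht]; positivity
  have hD : 0 ≤ δθ + δu ^ 2 := by positivity
  have hGB0 : 0 ≤ γ * B := mul_nonneg hγ.le hB0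
  have h1 : C₂ ^ (m ^ 3) ≤ Real.exp (C₂ * (l ^ 3)⁻¹) := by
    have hml3 : ((m ^ 3 : ℕ) : ℝ) ≤ (l ^ 3)⁻¹ := by
      rw [Nat.cast_pow, ← inv_pow, ← one_div]
      exact pow_le_pow_left₀ hmR.le hmle 3
    calc C₂ ^ (m ^ 3) ≤ Real.exp C₂ ^ (m ^ 3) :=
          pow_le_pow_left₀ hC₂ (by linarith [Real.add_one_le_exp C₂]) _
      _ = Real.exp ((m ^ 3 : ℕ) * C₂) := (Real.exp_nat_mul C₂ (m ^ 3)).symm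
      _ ≤ Real.exp (C₂ * (l ^ 3)⁻¹) := Real.exp_le_exp.2 (by rw [mul_comm]; exact mul_le_mul_of_nonneg_left hml3 hC₂)
  have h2 : n * (C₂ * t ^ 2 + t * (C₂ * (δθ + δu ^ 2))) + C₂ * (l ^ 3)⁻¹ ≤
      n * (64 * C₂ * (γ * B) ^ 2 + γ * B * (64 * C₂ * (δθ + δu ^ 2)) + 64 * C₂ * (n * l ^ 3)⁻¹) := by
    have ha' : C₂ * t ^ 2 ≤ 64 * C₂ * (γ * B) ^ 2 := by
      have : t ^ 2 ≤ (8 * (γ * B)) ^ 2 := pow_le_pow_left₀ ht0 hsl 2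
      nlinarith
    have hb' : t * (C₂ * (δθ + δu ^ 2)) ≤ γ * B * (64 * C₂ * (δθ + δu ^ 2)) := by
      have : t * (C₂ * (δθ + δu ^ 2)) ≤ 8 * (γ * B) * (C₂ * (δθ + δu ^ 2)) :=
        mul_le_mul_of_nonneg_right hsl (mul_nonneg hC₂ hD)
      nlinarith [mul_nonneg hGB0 (mul_nonneg hC₂ hD)]
    have hc' : C₂ * (l ^ 3)⁻¹ ≤ n * (64 * C₂ * (n * l ^ 3)⁻¹) := by
      rw [mul_inv, show n * (64 * C₂ * (n⁻¹ * (l ^ 3)⁻¹)) = 64 * (n * n⁻¹) * (C₂ * (l ^ 3)⁻¹) by ring,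
        mul_inv_cancel₀ hnpos.ne', mul_one]
      have : 0 ≤ C₂ * (l ^ 3)⁻¹ := by positivity
      linarith
    nlinarith [mul_le_mul_of_nonneg_left (add_le_add ha' hb') hnpos.le]
  calc C₂ ^ (m ^ 3) * Real.exp (n * (C₂ * t ^ 2 + t * (C₂ * (δθ + δu ^ 2))))
      ≤ Real.exp (C₂ * (l ^ 3)⁻¹) * Real.exp (n * (C₂ * t ^ 2 + t * (C₂ * (δθ + δu ^ 2)))) :=
        mul_le_mul_of_nonneg_right h1 (Real.exp_pos _).le
    _ = Real.exp (n * (C₂ * t ^ 2 + t * (C₂ * (δθ + δu ^ 2))) + C₂ * (l ^ 3)⁻¹) := by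
        rw [← Real.exp_add, add_comm]
    _ ≤ _ := Real.exp_le_exp.2 h2

end FluxClosureEnt
end Summit.AtomisticToContinuum.HydrodynamicLimit.Theorems

end
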